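import Summits.QuantumFields.BalabanUV.Beta.FP.PerfectMaxwellSymbol
import Summits.QuantumFields.BalabanUV.Beta.KernelPermutation

/-!
# `BalabanUV.Beta.FP.PerfectSymbolPerm` — road «FP» for binder row D1, row PERM-COV in MOMENTUM SPACE (owner rows of H2-DESIGN; H2-P ∕ H2-G): the
# continuum (1.66) multiplier in closed form `PerfectSymbol166.W166Inf` and the weighted Maxwell form `PerfectMaxwellSymbol.maxwellQ` are
# COVARIANT UNDER PERMUTATIONS OF THE AXES — `W_∞(σμ, σν; σ•p) = W_∞(μ, ν; p)`, `maxwellQ W (σ•ph) (σ•v) = maxwellQ (W ∘ (σ×σ)) ph v`, hence the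
# perfect Laplacian's weighted Maxwell symbol is permutation-INVARIANT: `maxwellQ (Re W_∞(·,·;σ•s)) (σ•ph) (σ•v) = maxwellQ (Re W_∞(·,·;s)) ph v`

HONEST DEPENDENCY (page 1, mandatory): continuum YM on T⁴ ⇐ BetaPertH ∧ nine spine estimates (0/9 proved); BetaPertH ⇐ (D1) ∧ (D4) ∧ CAP+tail;
G-an2-4 gates asym, D1 and NE2/3/4.  HONEST FRAMING (cell contract, verbatim): «discharging `BetaPertH` makes Bałaban's UV stability UNCONDITIONAL —
a real constructive-QFT result; it is NOT the continuum limit and NOT the Clay problem.»  THIS MODULE DISCHARGES NOTHING of the wall: [folklore] re-indexing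
of finite sums ∕ products over `Fin d` and of one `tsum` over `ℤ^d` by a permutation (Mathlib), applied to the tree's closed-form definitions (`uInf`, `UInf`,
`SqInf`, `TInf`, `RtInf`, `cfacInf`, `D0Inf`, `YcInf`, `F66Inf`, `W166Inf` of `FP/PerfectSymbolAlias` ∕ `FP/PerfectSymbol166`; `maxwellQ` of
`FP/PerfectMaxwellSymbol`) with MODULE 1's axis action `KernelPermutation.psite σ : x ↦ x ∘ σ⁻¹`.  No `def`, no `def … : Prop`, nothing cited, 0 sorry;
0 wall binders; NOT D1, NOT BetaPertH, NOT continuum, NOT Clay.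
WHY (row PERM-COV after the located obstruction F-d1leaf01g7-1): on the LATTICE side the permutation letter of comb-rooted tables is not available by
transport (`CombPermutationWitness`, p230343); road FP's H-route works at the fixed point with SYMBOLS (owner's H2-P: `PerfectMaxwellSymbol` p229918,
`PerfectMaxwellElliptic` p230467), where the hyperoctahedral letters ARE available: this file supplies the PERMUTATION half for the objects of record
there — the input «covariance under the hyperoctahedral letters» of H2-G's germ argument (`MarginalUniqueness.cubic_unique`'s `PermInvariant`) for
everything built from `W_∞` and the Maxwell ∕ Feynman-completed symbols.  (For the VECTOR-indexed Maxwell form the reflection half involves the bond re-basing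
phase of the momentum factors and is NOT here; for the SCALAR multiplier `W_∞(μ,ν;p)` it is §4.)
CONTENT ([folklore]):
* §1 alias level: `UInf_psite`, `SqInf_psite`, `TInf_psite`, `RtInf_psite` (the `ℤ^d` alias series re-indexed by `psite σ`), `cfacInf_psite`, `D0Inf_psite`,
  `YcInf_psite : YcInf (σ λ) (σ•p) = YcInf λ p`.
* §2 `F66Inf_psite : F66Inf (σ•p) = F66Inf p` (the regrouped denominator: the subset sum over `T ⊆ univ ∖ {λ}` re-indexed by `T ↦ σ(T)`), and
  **`W166Inf_psite : W166Inf (σ μ) (σ ν) (σ•p) = W166Inf μ ν p`** — (1.21)'s permutation covariance for the perfect multiplier, as an identity of the closed form.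
* §3 **`maxwellQ_psite`**, **`maxwellQ_W166Inf_psite`**, `feynman_term_psite` (the slice term `‖⟪ph,v⟫‖²` is invariant), `psite_mem_BZ`, `ofRealVec_psite`.
* §4 the SIGN part of the hyperoctahedral group for the multiplier: `cflip α` (sign flip of one coordinate), `uInf_neg_neg` (`u_∞` is even), `RtInf_cflip`,
  `F66Inf_cflip`, **`W166Inf_cflip : W166Inf μ ν (ε_α•p) = W166Inf μ ν p`** — with §2, `W_∞` is invariant under the whole hyperoctahedral group `B_d`.
Unit `b2b-balaban-beta-d1-formalise-leaf-01` (gen 7), 2026-08-20; claim table `HOME/b2b-balaban-beta-d1-p3/LEAVES-FP.md` sub-row PERM-COV.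
ABSOLUTE RULE (cell charter, verbatim): «No internally-minted statement may enter as a cited fact. Every hypothesis is either kernel-proved in this package or a
verbatim quotation of a PUBLISHED theorem with page reference. The manuscript(s) under audit are NOT citable for their own disputed steps — they are the thing
under adjudication; programme-internal (2001/route/tribunal) claims are never citable.»
-/

noncomputable section

namespace Summit.QuantumFields.BalabanUV.Beta.FP.PerfectSymbolPerm

open Finset
open scoped BigOperators ComplexConjugate
open Literature.MathematicalPhysics.QuantumFieldTheory.Balaban1983to89
open B4Strip (S1 ofRealVec)
open B4ContourShift (BZ)
open Summit.QuantumFields.BalabanUV.Beta.KernelPermutation (psite psite_apply psite_zero psite_eq_zero_iff psite_inv_psite psite_psite_inv)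
open Summit.QuantumFields.BalabanUV.Beta.FP.PerfectSymbolAlias (uInf UInf SqInf)
open Summit.QuantumFields.BalabanUV.Beta.FP.PerfectSymbol166 (TInf RtInf cfacInf D0Inf YcInf F66Inf W166Inf)
open Summit.QuantumFields.BalabanUV.Beta.FP.PerfectMaxwellSymbol (maxwellQ)

variable {d : ℕ} (σ : Equiv.Perm (Fin d))

/-! ## §1 The alias-level objects -/

/-- [folklore] `U_∞(σ•l; σ•p) = U_∞(l; p)` (a product over the coordinates). -/
theorem UInf_psite (l : Fin d → ℤ) (p : Fin d → ℂ) : UInf (psite σ l) (psite σ p) = UInf l p := by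
  unfold UInf
  exact Equiv.prod_comp σ.symm (fun ν => uInf (l ν) (p ν))

/-- [folklore] `U_∞(0; σ•p) = U_∞(0; p)`. -/
theorem UInf_zero_psite (p : Fin d → ℂ) : UInf 0 (psite σ p) = UInf 0 p := by
  have h := UInf_psite σ 0 p
  rwa [psite_zero] at h

/-- [folklore] `Σ_ν ((σ•p)_ν + 2π(σ•l)_ν)² = Σ_ν (p_ν + 2πl_ν)²`. -/
theorem SqInf_psite (l : Fin d → ℤ) (p : Fin d → ℂ) : SqInf (psite σ l) (psite σ p) = SqInf l p := by
  unfold SqInf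
  exact Equiv.sum_comp σ.symm (fun ν => (p ν + 2 * Real.pi * ((l ν : ℤ) : ℂ)) ^ 2)

/-- [folklore] The alias term: `T_∞(σλ; σ•l; σ•p) = T_∞(λ; l; p)`. -/
theorem TInf_psite (lam : Fin d) (l : Fin d → ℤ) (p : Fin d → ℂ) : TInf (σ lam) (psite σ l) (psite σ p) = TInf lam l p := by
  unfold TInf
  rw [UInf_psite, SqInf_psite, psite_apply, psite_apply, Equiv.symm_apply_apply]

/-- [folklore] **THE ALIAS SERIES IS PERMUTATION-COVARIANT**: `R̃_∞(σλ; σ•p) = R̃_∞(λ; p)` (the `tsum` over `ℤ^d ∖ 0` re-indexed by `l ↦ σ•l`). -/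
theorem RtInf_psite (lam : Fin d) (p : Fin d → ℂ) : RtInf (σ lam) (psite σ p) = RtInf lam p := by
  unfold RtInf
  rw [← Equiv.tsum_eq (psite (β := ℤ) σ) (fun l => if l = 0 then (0 : ℂ) else TInf (σ lam) l (psite σ p))]
  refine tsum_congr fun l => ?_
  simp only [psite_eq_zero_iff, TInf_psite]

/-- [folklore] The `l = 0` factor: `c_∞(σλ; σ•p) = c_∞(λ; p)`. -/
theorem cfacInf_psite (lam : Fin d) (p : Fin d → ℂ) : cfacInf (σ lam) (psite σ p) = cfacInf lam p := by
  unfold cfacInf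
  rw [UInf_zero_psite, psite_apply, Equiv.symm_apply_apply]

/-- [folklore] The continuum Laplacian symbol is permutation-invariant. -/
theorem D0Inf_psite (p : Fin d → ℂ) : D0Inf (psite σ p) = D0Inf p := by
  unfold D0Inf
  exact Equiv.sum_comp σ.symm (fun ν => p ν ^ 2)

/-- [folklore] `Y_∞(σλ; σ•p) = Y_∞(λ; p)`. -/
theorem YcInf_psite (lam : Fin d) (p : Fin d → ℂ) : YcInf (σ lam) (psite σ p) = YcInf lam p := by
  unfold YcInf
  rw [cfacInf_psite, D0Inf_psite, RtInf_psite]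

/-! ## §2 The regrouped denominator and the closed-form multiplier -/

/-- [folklore] The index set `{T ⊆ univ ∖ {σ a}, T ≠ ∅}` is the `σ`-image of `{T ⊆ univ ∖ {a}, T ≠ ∅}` (re-indexing data for `F66Inf`). -/
theorem map_mem_index {a : Fin d} {T : Finset (Fin d)} (hT : T ∈ ((univ.erase a).powerset).erase ∅) :
    T.map σ.toEmbedding ∈ ((univ.erase (σ a)).powerset).erase ∅ := by
  rw [mem_erase, mem_powerset] at hT ⊢
  refine ⟨?_, fun x hx => ?_⟩
  · intro h
    exact hT.1 (Finset.map_eq_empty.1 h)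
  · rw [mem_map] at hx
    obtain ⟨y, hy, rfl⟩ := hx
    have hy' := hT.2 hy
    rw [mem_erase] at hy' ⊢
    exact ⟨fun e => hy'.1 (σ.injective e), mem_univ _⟩

/-- [folklore] Mapping back by `σ⁻¹` then by `σ` is the identity on finsets. -/
theorem map_inv_map (T : Finset (Fin d)) : (T.map σ⁻¹.toEmbedding).map σ.toEmbedding = T := by
  rw [Finset.map_map]
  convert Finset.map_refl (s := T) using 2
  ext x
  simp [Equiv.Perm.inv_def]

/-- [folklore] Mapping by `σ` then back by `σ⁻¹` is the identity on finsets. -/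
theorem map_map_inv (T : Finset (Fin d)) : (T.map σ.toEmbedding).map σ⁻¹.toEmbedding = T := by
  rw [Finset.map_map]
  convert Finset.map_refl (s := T) using 2
  ext x
  simp [Equiv.Perm.inv_def]

/-- [folklore] **THE REGROUPED DENOMINATOR IS PERMUTATION-INVARIANT**: `F_∞(σ•p) = F_∞(p)`. -/
theorem F66Inf_psite (p : Fin d → ℂ) : F66Inf (psite σ p) = F66Inf p := by
  unfold F66Inf
  rw [UInf_zero_psite]
  congr 1
  rw [← Equiv.sum_comp σ (fun lam => S1 (psite σ p lam) * ∑ T ∈ ((univ.erase lam).powerset).erase ∅,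
    D0Inf (psite σ p) ^ (T.card - 1) * ((∏ lam' ∈ T, RtInf lam' (psite σ p)) * ∏ lam' ∈ (univ.erase lam) \ T, cfacInf lam' (psite σ p)))]
  refine sum_congr rfl fun a _ => ?_
  rw [psite_apply, Equiv.symm_apply_apply, D0Inf_psite]
  congr 1
  -- re-index the subset sum by `T ↦ σ(T)`
  symm
  refine Finset.sum_nbij' (fun T => T.map σ.toEmbedding) (fun T => T.map σ⁻¹.toEmbedding) (fun T hT => map_mem_index σ hT)
    (fun T hT => ?_) (fun T _ => map_map_inv σ T) (fun T _ => map_inv_map σ T) (fun T hT => ?_)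
  · have h := map_mem_index σ⁻¹ hT
    simpa only [Equiv.Perm.inv_def, Equiv.symm_apply_apply] using h
  · rw [Finset.card_map, Finset.prod_map]
    congr 1
    congr 1
    · exact Finset.prod_congr rfl fun lam' _ => by rw [Equiv.coe_toEmbedding, RtInf_psite]
    · have hs : (univ.erase (σ a)) \ T.map σ.toEmbedding = ((univ.erase a) \ T).map σ.toEmbedding := by
        rw [Finset.map_sdiff, Finset.map_erase, Finset.map_univ_equiv, Equiv.coe_toEmbedding]
      rw [hs, Finset.prod_map]
      exact Finset.prod_congr rfl fun lam' _ => by rw [Equiv.coe_toEmbedding, cfacInf_psite]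

/-- [folklore] **THE CONTINUUM (1.66) MULTIPLIER IS PERMUTATION-COVARIANT** (the permutation half of (1.21) p. 264 for the perfect multiplier, as an identity of
the closed form): `W_∞(σ μ, σ ν; σ•p) = W_∞(μ, ν; p)` for every `σ`, `μ`, `ν`, `p`. -/
theorem W166Inf_psite (μ ν : Fin d) (p : Fin d → ℂ) : W166Inf (σ μ) (σ ν) (psite σ p) = W166Inf μ ν p := by
  unfold W166Inf
  rw [F66Inf_psite]
  congr 1
  have hs : (univ.erase (σ μ)).erase (σ ν) = ((univ.erase μ).erase ν).map σ.toEmbedding := by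
    rw [Finset.map_erase, Finset.map_erase, Finset.map_univ_equiv, Equiv.coe_toEmbedding]
  rw [hs, Finset.prod_map]
  exact Finset.prod_congr rfl fun lam _ => by rw [Equiv.coe_toEmbedding, YcInf_psite]

/-! ## §3 The weighted Maxwell form and the Feynman slice term -/

/-- [folklore] **PERMUTATION COVARIANCE OF THE WEIGHTED MAXWELL FORM**: permuting the momentum factors and the amplitude is the same as permuting the
weight family: `maxwellQ W (σ•ph) (σ•v) = maxwellQ (fun μ ν => W (σ μ) (σ ν)) ph v`. -/
theorem maxwellQ_psite (W : Fin d → Fin d → ℝ) (ph v : Fin d → ℂ) :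
    maxwellQ W (psite σ ph) (psite σ v) = maxwellQ (fun μ ν => W (σ μ) (σ ν)) ph v := by
  unfold maxwellQ
  rw [← Equiv.sum_comp σ]
  refine sum_congr rfl fun μ _ => ?_
  rw [← Equiv.sum_comp σ]
  refine sum_congr rfl fun ν _ => ?_
  simp only [psite_apply, Equiv.symm_apply_apply, EmbeddingLike.apply_eq_iff_eq]

/-- [folklore] **THE PERFECT LAPLACIAN's WEIGHTED MAXWELL SYMBOL IS PERMUTATION-INVARIANT**: with the weights `Re W_∞(·,·; p)`,
`maxwellQ (Re W_∞(·,·;σ•p)) (σ•ph) (σ•v) = maxwellQ (Re W_∞(·,·;p)) ph v`. -/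
theorem maxwellQ_W166Inf_psite (p ph v : Fin d → ℂ) :
    maxwellQ (fun μ ν => (W166Inf μ ν (psite σ p)).re) (psite σ ph) (psite σ v) = maxwellQ (fun μ ν => (W166Inf μ ν p).re) ph v := by
  rw [maxwellQ_psite]
  congr 1
  funext μ ν
  rw [W166Inf_psite]

/-- [folklore] The Feynman slice term `‖Σ_μ ph μ·conj(v μ)‖²` (the lattice divergence symbol) is permutation-invariant. -/
theorem feynman_term_psite (ph v : Fin d → ℂ) :
    ‖∑ μ, psite σ ph μ * conj (psite σ v μ)‖ ^ 2 = ‖∑ μ, ph μ * conj (v μ)‖ ^ 2 := by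
  congr 2
  exact Equiv.sum_comp σ.symm (fun μ => ph μ * conj (v μ))

/-- [folklore] The squared norms `Σ‖ph‖²`, `Σ‖v‖²` are permutation-invariant (bookkeeping for `PerfectMaxwellElliptic.feynman_lower/upper`). -/
theorem normSq_sum_psite (w : Fin d → ℂ) : ∑ μ, ‖psite σ w μ‖ ^ 2 = ∑ μ, ‖w μ‖ ^ 2 :=
  Equiv.sum_comp σ.symm (fun μ => ‖w μ‖ ^ 2)

/-- [folklore] Real momenta: `σ•(ofRealVec s) = ofRealVec (σ•s)`. -/
theorem ofRealVec_psite (s : Fin d → ℝ) : psite σ (ofRealVec s) = ofRealVec (psite σ s) := rfl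

/-- [folklore] The Brillouin zone is permutation-invariant. -/
theorem psite_mem_BZ {s : Fin d → ℝ} (hs : s ∈ BZ d) : psite σ s ∈ BZ d := by
  simp only [BZ, Set.mem_Icc, Pi.le_def] at hs ⊢
  exact ⟨fun i => hs.1 _, fun i => hs.2 _⟩

/-- [our object] **ON THE REAL ZONE**: the perfect weighted Maxwell symbol at the permuted real momentum, with permuted momentum factors and amplitude, equals the
one at `s` — the permutation letter for everything road FP's H-route builds from `maxwellQ (Re W_∞)` (H2-P ∕ H2-G). -/
theorem maxwellQ_W166Inf_ofRealVec_psite (s : Fin d → ℝ) (ph v : Fin d → ℂ) :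
    maxwellQ (fun μ ν => (W166Inf μ ν (ofRealVec (psite σ s))).re) (psite σ ph) (psite σ v)
      = maxwellQ (fun μ ν => (W166Inf μ ν (ofRealVec s)).re) ph v := by
  rw [← ofRealVec_psite, maxwellQ_W166Inf_psite]

/-! ## §4 The reflection half for the multiplier: `W_∞(μ,ν; p)` is EVEN in every coordinate of `p` -/

section Reflection

variable {β : Type*}

/-- [folklore] Sign flip of the coordinate `α` (the linear part of an axis reflection acting on momenta ∕ alias vectors). -/
def cflip [Neg β] (α : Fin d) (x : Fin d → β) : Fin d → β := fun i => if i = α then -x i else x i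

/-- [folklore] Coordinates of the flipped vector. -/
@[simp] theorem cflip_apply [Neg β] (α : Fin d) (x : Fin d → β) (i : Fin d) : cflip α x i = if i = α then -x i else x i := rfl

/-- [folklore] `cflip α` is an involution. -/
theorem cflip_cflip [InvolutiveNeg β] (α : Fin d) (x : Fin d → β) : cflip α (cflip α x) = x := by
  funext i; by_cases h : i = α <;> simp [cflip_apply, h]

/-- [folklore] `cflip α` on `ℤ^d` as an `Equiv` (for re-indexing the alias series). -/
def cflipEquiv (α : Fin d) : (Fin d → ℤ) ≃ (Fin d → ℤ) := Function.Involutive.toPerm (cflip α) (cflip_cflip α)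

/-- [folklore] Only the origin flips to the origin. -/
theorem cflip_eq_zero_iff (α : Fin d) (l : Fin d → ℤ) : cflip α l = 0 ↔ l = 0 := by
  constructor
  · intro h
    have h' := congrArg (cflip α) h
    rw [cflip_cflip] at h'
    rw [h']
    funext i; by_cases hi : i = α <;> simp [cflip_apply, hi]
  · intro h
    rw [h]
    funext i; by_cases hi : i = α <;> simp [cflip_apply, hi]

/-- [folklore] **THE ONE-COORDINATE WEIGHT IS EVEN**: `u_∞(−l; −z) = u_∞(l; z)` (`S₁` is even; `(−z − 2πl)² = (z + 2πl)²`). -/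
theorem uInf_neg_neg (l : ℤ) (z : ℂ) : uInf (-l) (-z) = uInf l z := by
  unfold uInf
  have hS : S1 (-z) = S1 z := by unfold S1; rw [Complex.cos_neg]
  have hq : (-z + 2 * Real.pi * ((-l : ℤ) : ℂ)) ^ 2 = (z + 2 * Real.pi * (l : ℂ)) ^ 2 := by push_cast; ring
  simp only [neg_eq_zero, hS, hq]

/-- [folklore] `u_∞` at a flipped coordinate pair. -/
theorem uInf_cflip (α : Fin d) (l : Fin d → ℤ) (p : Fin d → ℂ) (ν : Fin d) :
    uInf (cflip α l ν) (cflip α p ν) = uInf (l ν) (p ν) := by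
  by_cases h : ν = α
  · simp only [cflip_apply, h, if_true, uInf_neg_neg]
  · simp only [cflip_apply, h, if_false]

/-- [folklore] `U_∞(ε•l; ε•p) = U_∞(l; p)`. -/
theorem UInf_cflip (α : Fin d) (l : Fin d → ℤ) (p : Fin d → ℂ) : UInf (cflip α l) (cflip α p) = UInf l p := by
  unfold UInf
  exact Finset.prod_congr rfl fun ν _ => uInf_cflip α l p ν

/-- [folklore] `U_∞(0; ε•p) = U_∞(0; p)`. -/
theorem UInf_zero_cflip (α : Fin d) (p : Fin d → ℂ) : UInf 0 (cflip α p) = UInf 0 p := by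
  have h := UInf_cflip α 0 p
  have h0 : cflip α (0 : Fin d → ℤ) = 0 := (cflip_eq_zero_iff α 0).2 rfl
  rwa [h0] at h

/-- [folklore] `Σ_ν ((ε•p)_ν + 2π(ε•l)_ν)² = Σ_ν (p_ν + 2πl_ν)²`. -/
theorem SqInf_cflip (α : Fin d) (l : Fin d → ℤ) (p : Fin d → ℂ) : SqInf (cflip α l) (cflip α p) = SqInf l p := by
  unfold SqInf
  refine Finset.sum_congr rfl fun ν _ => ?_
  by_cases h : ν = α
  · simp only [cflip_apply, h, if_true]; push_cast; ring
  · simp only [cflip_apply, h, if_false]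

/-- [folklore] The alias term at the flipped pair. -/
theorem TInf_cflip (α lam : Fin d) (l : Fin d → ℤ) (p : Fin d → ℂ) : TInf lam (cflip α l) (cflip α p) = TInf lam l p := by
  unfold TInf
  rw [UInf_cflip, SqInf_cflip, uInf_cflip]

/-- [folklore] **THE ALIAS SERIES IS EVEN IN EVERY COORDINATE**: `R̃_∞(λ; ε•p) = R̃_∞(λ; p)` (re-indexed by `l ↦ ε•l`). -/
theorem RtInf_cflip (α lam : Fin d) (p : Fin d → ℂ) : RtInf lam (cflip α p) = RtInf lam p := by
  unfold RtInf
  rw [← Equiv.tsum_eq (cflipEquiv α) (fun l => if l = 0 then (0 : ℂ) else TInf lam l (cflip α p))]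
  refine tsum_congr fun l => ?_
  show (if cflip α l = 0 then (0 : ℂ) else TInf lam (cflip α l) (cflip α p)) = if l = 0 then 0 else TInf lam l p
  simp only [cflip_eq_zero_iff, TInf_cflip]

/-- [folklore] `c_∞(λ; ε•p) = c_∞(λ; p)`. -/
theorem cfacInf_cflip (α lam : Fin d) (p : Fin d → ℂ) : cfacInf lam (cflip α p) = cfacInf lam p := by
  unfold cfacInf
  rw [UInf_zero_cflip]
  congr 1
  have h := uInf_cflip α 0 p lam
  have h0 : cflip α (0 : Fin d → ℤ) = 0 := (cflip_eq_zero_iff α 0).2 rfl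
  rw [h0] at h
  exact h

/-- [folklore] `Σ p_ν²` is even in every coordinate. -/
theorem D0Inf_cflip (α : Fin d) (p : Fin d → ℂ) : D0Inf (cflip α p) = D0Inf p := by
  unfold D0Inf
  refine Finset.sum_congr rfl fun ν _ => ?_
  by_cases h : ν = α
  · simp only [cflip_apply, h, if_true, neg_sq]
  · simp only [cflip_apply, h, if_false]

/-- [folklore] `Y_∞(λ; ε•p) = Y_∞(λ; p)`. -/
theorem YcInf_cflip (α lam : Fin d) (p : Fin d → ℂ) : YcInf lam (cflip α p) = YcInf lam p := by
  unfold YcInf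
  rw [cfacInf_cflip, D0Inf_cflip, RtInf_cflip]

/-- [folklore] `F_∞(ε•p) = F_∞(p)` (termwise: `S₁` even, `R̃_∞`, `c_∞`, `Σp²` even). -/
theorem F66Inf_cflip (α : Fin d) (p : Fin d → ℂ) : F66Inf (cflip α p) = F66Inf p := by
  unfold F66Inf
  rw [UInf_zero_cflip, D0Inf_cflip]
  congr 1
  refine Finset.sum_congr rfl fun lam _ => ?_
  have hS : S1 (cflip α p lam) = S1 (p lam) := by
    by_cases h : lam = α
    · simp only [cflip_apply, h, if_true]; unfold S1; rw [Complex.cos_neg]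
    · simp only [cflip_apply, h, if_false]
  rw [hS]
  congr 1
  refine Finset.sum_congr rfl fun T _ => ?_
  rw [Finset.prod_congr rfl fun lam' _ => RtInf_cflip α lam' p, Finset.prod_congr rfl fun lam' _ => cfacInf_cflip α lam' p]

/-- [folklore] **THE CONTINUUM (1.66) MULTIPLIER IS EVEN IN EVERY MOMENTUM COORDINATE**: `W_∞(μ, ν; ε_α•p) = W_∞(μ, ν; p)` — with §2, `W_∞` is invariant under
the whole hyperoctahedral group (indices relabelled by the permutation part, untouched by the sign part). -/
theorem W166Inf_cflip (α μ ν : Fin d) (p : Fin d → ℂ) : W166Inf μ ν (cflip α p) = W166Inf μ ν p := by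
  unfold W166Inf
  rw [F66Inf_cflip, Finset.prod_congr rfl fun lam _ => YcInf_cflip α lam p]

end Reflection

end Summit.QuantumFields.BalabanUV.Beta.FP.PerfectSymbolPerm

end
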